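import Literature.AlgebraicGeometry.Motives.MorphismsToProjectiveSpace
import HarnessLib

/-!
# Pull-back of generating sections along a morphism, and the morphism to `ℙ(ι)` it defines

Topic `AlgebraicGeometry/Motives`; namespace `Literature.AlgebraicGeometry.Motives.GeneratingSections`. ONE definition
(`GeneratingSections.comap`) + theorems; no instance, no notation, no named fact, no `sorry`.

`GeneratingSections ι Y` (★ `Motives/MorphismsToProjectiveSpace`, Hartshorne II Thm. 7.1 in chart form) is the datum of an
invertible sheaf `𝓛` on `Y` with generating sections `(sᵢ)_{i ∈ ι}`, recorded as the opens `U i = Y_{sᵢ}` and the ratios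
`s_j/s_i ∈ Γ(Y, U i)`. For a morphism `h : T → Y` the pulled-back sheaf `h^*𝓛` with the pulled-back sections `h^*sᵢ` is again
such a datum: opens `h⁻¹(U i)`, ratios `h^*(s_j/s_i)` — this is `GeneratingSections.comap D h`. The morphism to projective space
is functorial: **`(D.comap h).toProj (h ≫ f) = h ≫ D.toProj f`** (`comap_toProj`; Görtz–Wedhorn I (13.8): the `T`-valued point
`h` of `Y` followed by `Y → ℙ(ι)` is the point given by `(h^*𝓛, h^*sᵢ)`; uniqueness in Hartshorne II Thm. 7.1 (b)).

* `comap`, `comap_U`, `comap_ratio` — the definition and its fields;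
* `comap_chartFun`, `comap_chartRingHom`, `comap_chartMap` — the chart maps of the pulled-back datum are those of `D` along
  `T' → T → Y` (★ `chartMap` is functorial in the test scheme);
* **`comap_toProj`** — functoriality of `toProj`;
* `isAffineOpen_comap_U` — for `h` affine the pulled-back charts are affine (hypothesis shape of ★ `isClosedImmersion_toProj`);
* `comap_comp`, `comap_comap_U`, `comap_comap_toProj` (edition 2) — functoriality `D.comap (h' ≫ h) = (D.comap h).comap h'` (`rfl`).

Bridge (B1) of the cell's (h2) leaf «fibrewise very ample ⇒ closed immersion near the fibre» (EGA III 4.7.1): the fibre datum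
`D.comap (X_𝔭 → X)`. Count-neutral capital (HC_CM is proved only modulo the 7 printed citations until rung 0 closes).

## References
* R. Hartshorne, *Algebraic Geometry* (1977), II Thm. 7.1. [Hartshorne1977]
* U. Görtz, T. Wedhorn, *Algebraic Geometry I*, 2nd ed. (2020), §(13.8) (the functor of points of `ℙⁿ`: `S`-morphisms `T → ℙⁿ_S`
  are line-bundle quotients, functorially in `T`) — background only, not cited by item.
-/

noncomputable section

universe u

open CategoryTheory CategoryTheory.Limits AlgebraicGeometry HomogeneousLocalization TopologicalSpace Opposite
open MvPolynomial (X C)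
open Literature.AlgebraicGeometry.Motives.Segre

namespace Literature.AlgebraicGeometry.Motives

namespace GeneratingSections

attribute [local instance] MvPolynomial.gradedAlgebra

variable {ι : Type} {Y T T' : Scheme.{u}} (D : GeneratingSections ι Y) (h : T ⟶ Y)

/-- Restriction after pull-back is pull-back (`appLE`) after restriction (naturality of `h^*`, elementwise). [folklore] -/
private theorem map_app_eq {U V : Y.Opens} {W : T.Opens} (eVU : V ≤ U) (eW : W ≤ h ⁻¹ᵁ V) (eW' : W ≤ h ⁻¹ᵁ U)
    (r : Γ(Y, U)) :
    T.presheaf.map (homOfLE eW').op (h.app U r) = h.appLE V W eW (Y.presheaf.map (homOfLE eVU).op r) := by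
  have h1 : h.app U ≫ T.presheaf.map (homOfLE eW').op = Y.presheaf.map (homOfLE eVU).op ≫ h.appLE V W eW := by
    rw [Scheme.Hom.app_eq_appLE, Scheme.Hom.appLE_map, Scheme.Hom.map_appLE]
  have h2 := ConcreteCategory.congr_hom h1 r
  rwa [CommRingCat.comp_apply, CommRingCat.comp_apply] at h2

/-- **Pull-back of generating sections** along `h : T → Y`: the opens `h⁻¹(U i)` and the ratios `h^*(s_j/s_i)` (the datum of
`h^*𝓛` with the sections `h^*sᵢ`; Görtz–Wedhorn I (13.8), Hartshorne II Thm. 7.1). [cite: Hartshorne1977, II Thm. 7.1] -/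
def comap : GeneratingSections ι T where
  U i := h ⁻¹ᵁ D.U i
  iSup_U := by rw [← Scheme.Hom.preimage_iSup, D.iSup_U]; rfl
  ratio i j := h.app (D.U i) (D.ratio i j)
  ratio_self i := by rw [D.ratio_self, map_one]
  basicOpen_ratio i j := by rw [← Scheme.preimage_basicOpen, D.basicOpen_ratio]; rfl
  ratio_mul_ratio i j l := by
    have e₀ : h ⁻¹ᵁ D.U i ⊓ h ⁻¹ᵁ D.U j ≤ h ⁻¹ᵁ (D.U i ⊓ D.U j) := fun _ hx ↦ hx
    rw [map_app_eq h (inf_le_left : D.U i ⊓ D.U j ≤ D.U i) e₀ inf_le_left (D.ratio i j),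
      map_app_eq h (inf_le_right : D.U i ⊓ D.U j ≤ D.U j) e₀ inf_le_right (D.ratio j l),
      map_app_eq h (inf_le_left : D.U i ⊓ D.U j ≤ D.U i) e₀ inf_le_left (D.ratio i l), ← map_mul,
      D.ratio_mul_ratio]

/-- The opens of the pulled-back datum are the preimages `h⁻¹(U i)` (`rfl`). [cite: Hartshorne1977, II Thm. 7.1] -/
@[simp]
theorem comap_U (i : ι) : (D.comap h).U i = h ⁻¹ᵁ D.U i := rfl

/-- The ratios of the pulled-back datum are the pulled-back ratios `h^*(s_j/s_i)` (`rfl`). [cite: Hartshorne1977, II Thm. 7.1] -/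
@[simp]
theorem comap_ratio (i j : ι) : (D.comap h).ratio i j = h.app (D.U i) (D.ratio i j) := rfl

/-- For `h` affine, affine charts pull back to affine charts (hypothesis shape of Hartshorne II Prop. 7.2).
[cite: Hartshorne1977, II Prop. 7.2] -/
theorem isAffineOpen_comap_U [IsAffineHom h] {i : ι} (hU : IsAffineOpen (D.U i)) : IsAffineOpen ((D.comap h).U i) :=
  hU.preimage h

/-! ### The chart maps and `toProj` of the pulled-back datum -/

section Chart

variable {k : Type u} [CommRing k] (f : Y ⟶ Spec (.of k)) (i : ι) (g : T' ⟶ T)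

/-- `g : T' → T` landing in `h⁻¹(U i)` composed with `h` lands in `U i`. [folklore] -/
private theorem top_le_comp_preimage (hg : ⊤ ≤ g ⁻¹ᵁ (D.comap h).U i) : ⊤ ≤ (g ≫ h) ⁻¹ᵁ D.U i := by
  rw [Scheme.Hom.comp_preimage]; exact hg

variable (hg : ⊤ ≤ g ⁻¹ᵁ (D.comap h).U i)

include hg in
/-- Pulling back a section along `T' → T` after `T → Y` is pulling back along `T' → Y`. [folklore] -/
private theorem res_app (r : Γ(Y, D.U i)) :
    res g ((D.comap h).U i) hg (h.app (D.U i) r) = res (g ≫ h) (D.U i) (D.top_le_comp_preimage h i g hg) r := by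
  have h1 : h.app (D.U i) ≫ g.appLE (h ⁻¹ᵁ D.U i) ⊤ hg =
      (g ≫ h).appLE (D.U i) ⊤ (D.top_le_comp_preimage h i g hg) := by
    rw [Scheme.Hom.app_eq_appLE, Scheme.Hom.appLE_comp_appLE]
  have h2 := ConcreteCategory.congr_hom h1 r
  rw [CommRingCat.comp_apply] at h2
  exact h2

/-- The polynomial chart map `k[x] → Γ(T', 𝒪)` of the pulled-back datum along `g` is that of `D` along `g ≫ h`
(`x_j ↦ (g ≫ h)^*(s_j/s_i)`). [cite: Hartshorne1977, II Thm. 7.1 (proof)] -/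
theorem comap_chartFun :
    (D.comap h).chartFun (h ≫ f) i g hg = D.chartFun f i (g ≫ h) (D.top_le_comp_preimage h i g hg) := by
  apply MvPolynomial.ringHom_ext
  · intro c
    rw [chartFun_C, chartFun_C, Category.assoc]
  · intro j
    rw [chartFun_X, chartFun_X, comap_ratio, res_app]

/-- The chart ring map `(k[x]_{(xᵢ)})₀ → Γ(T', 𝒪)` of the pulled-back datum along `g` is that of `D` along `g ≫ h`.
[cite: Hartshorne1977, II Thm. 7.1 (proof)] -/
theorem comap_chartRingHom :
    (D.comap h).chartRingHom (h ≫ f) i g hg = D.chartRingHom f i (g ≫ h) (D.top_le_comp_preimage h i g hg) := by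
  have key : Localization.awayLift ((D.comap h).chartFun (h ≫ f) i g hg) (X i)
        ((D.comap h).isUnit_chartFun_X_self (h ≫ f) i g hg) =
      Localization.awayLift (D.chartFun f i (g ≫ h) (D.top_le_comp_preimage h i g hg)) (X i)
        (D.isUnit_chartFun_X_self f i (g ≫ h) (D.top_le_comp_preimage h i g hg)) := by
    apply IsLocalization.ringHom_ext (Submonoid.powers (X i : MvPolynomial ι k))
    rw [IsLocalization.Away.lift_comp, IsLocalization.Away.lift_comp]
    exact D.comap_chartFun h f i g hg
  unfold chartRingHom
  rw [key]

/-- The chart map `T' → D₊(xᵢ)` of the pulled-back datum along `g` is that of `D` along `g ≫ h`.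
[cite: Hartshorne1977, II Thm. 7.1 (proof)] -/
theorem comap_chartMap :
    (D.comap h).chartMap (h ≫ f) i g hg = D.chartMap f i (g ≫ h) (D.top_le_comp_preimage h i g hg) := by
  rw [chartMap, chartMap, comap_chartRingHom]

end Chart

/-- **Functoriality of the morphism to `ℙ(ι)`**: the morphism `T → ℙ(ι)_k` defined by the pulled-back datum `h^*(𝓛, sᵢ)` is
`h` followed by the morphism `Y → ℙ(ι)_k` defined by `(𝓛, sᵢ)` (Görtz–Wedhorn I (13.8); uniqueness in Hartshorne II
Thm. 7.1 (b)). [cite: Hartshorne1977, II Thm. 7.1 (b)] -/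
theorem comap_toProj {k : Type u} [CommRing k] (f : Y ⟶ Spec (.of k)) :
    (D.comap h).toProj (h ≫ f) = h ≫ D.toProj f := by
  refine Scheme.Cover.hom_ext (D.comap h).cover _ _ fun i ↦ ?_
  rw [cover_f, ι_toProj, chart, comap_chartMap, ← Category.assoc,
    D.comp_toProj f (((D.comap h).U i).ι ≫ h) (D.top_le_comp_preimage h i _ (top_le_ι_preimage _))]

/-- The pulled-back datum over `Spec k`: its morphism to `ℙ(ι)_k` lies over `T → Y → Spec k`. [cite: Hartshorne1977, II Thm. 7.1 (b)] -/
theorem comap_toProj_toSpec {k : Type u} [CommRing k] (f : Y ⟶ Spec (.of k)) :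
    (D.comap h).toProj (h ≫ f) ≫ toSpec ι k = h ≫ f :=
  toProj_toSpec _ _

/-- The preimages of the standard opens `D₊(x_j)` under the pulled-back morphism are the `h⁻¹(U j)` (`s_j = φ^*x_j`).
[cite: Hartshorne1977, II Thm. 7.1 (b)] -/
theorem comap_toProj_preimage_basicOpen {k : Type u} [CommRing k] (f : Y ⟶ Spec (.of k)) (j : ι) :
    (D.comap h).toProj (h ≫ f) ⁻¹ᵁ Proj.basicOpen (grading ι k) (X j) = h ⁻¹ᵁ D.U j :=
  toProj_preimage_basicOpen _ _ j


/-! ### Functoriality of the pull-back (edition 2) -/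

section Functoriality

variable {T'' : Scheme.{u}} (h' : T' ⟶ T)

/-- **Pull-back of generating sections is functorial**: pulling back along `h' ≫ h` is pulling back along `h`, then along
`h'` (both have opens `(h' ≫ h)⁻¹(U i) = h'⁻¹(h⁻¹(U i))` and ratios `(h' ≫ h)^*(s_j/s_i) = h'^*(h^*(s_j/s_i))`, definitionally).
[cite: Hartshorne1977, II Thm. 7.1] -/
theorem comap_comp : D.comap (h' ≫ h) = (D.comap h).comap h' := rfl

/-- The opens of an iterated pull-back. [cite: Hartshorne1977, II Thm. 7.1] -/
theorem comap_comap_U (i : ι) : ((D.comap h).comap h').U i = (h' ≫ h) ⁻¹ᵁ D.U i := rfl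

/-- The morphism to `ℙ(ι)` of an iterated pull-back: `((D.comap h).comap h').toProj (h' ≫ h ≫ f) = h' ≫ h ≫ D.toProj f`.
[cite: Hartshorne1977, II Thm. 7.1 (b)] -/
theorem comap_comap_toProj {k : Type u} [CommRing k] (f : Y ⟶ Spec (.of k)) :
    ((D.comap h).comap h').toProj (h' ≫ h ≫ f) = h' ≫ h ≫ D.toProj f := by
  rw [← comap_comp, ← Category.assoc, comap_toProj, Category.assoc]

end Functoriality

end GeneratingSections

end Literature.AlgebraicGeometry.Motives
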